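import Literature.Computability.QuantumComplexity.ConeSimStep
import Literature.Computability.Complexity.MajorityEnumeration
import HarnessLib

/-!
# The cone simulator, model: tables of the DP as lists, coefficient growth, window labels

Topic `Literature/Computability/QuantumComplexity`. Machine-independent bookkeeping between the
dynamic programme of `StateVectorDP.lean` (`dpStep`, `dpRun`, `dpInit`, `accU`, `accV` over a
label list `labs`) and the coded tables of the simulator (`ConeSimStep.lean`: `tableEnc`,
`partialSum`):

* `tblStep g l`, `tblRun gs l` — the list-level table through a gate list (the amplitude of `z`
  becomes `partialSum g z 0 l`; targets come out in reverse order), and **`tblRun_map`**: on the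
  table of a function `T` over `labs`, the run is the table of `dpRun gs labs T` over
  `reverse^{|gs|} labs` (`dpStep` does not depend on the order of the labels, `dpStep_perm`);
  `statU`, `statV` (the machine's sums) against `accU`, `accV` (`statU_map`, `statV_map`);
* **coefficient growth** `Bdd M a` (`|aᵢ| ≤ M`): a rotation keeps the bound, a contribution
  keeps it, a `dpStep`-sum over `L` labels multiplies it by `2L` (`bdd_tblStep`, `bdd_tblRun`:
  `(2L)^t`), whence the LENGTH bounds of the codes along a run in terms of one size parameter
  (`length_tableEnc_le`, `bdd_partialSum`, `natAbs_statU_le`, …) used to show that the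
  machine's clipping never bites;
* **window labels**: `winBits k w₀ j` (the tree's `k`-bit little-endian numeral
  `Complexity.natBits k j` of `StackUnaryBits.lean` followed by the suffix of `w₀` from position
  `k`; `natBits_eq_take`: it is what the machine computes, `(bin j ++ 0^k) ↾ k`), `winLab`, their
  enumeration `winLabs k w₀` of the `2^k` labels agreeing with `w₀` from position `k` on
  (`nodup_winLabs`, `mem_winLabs_iff`, via `CoinEnum.natBits_bitsToNat`), closure of that label set
  under the path steps of gates acting below `k` (`winSet_closed`), and `w₀ ∈` it.

## References

* M. A. Nielsen, I. L. Chuang, *Quantum Computation and Quantum Information*, CUP 2010, §4.5.5.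
* S. Arora, B. Barak, *Computational Complexity: A Modern Approach*, CUP 2009, §0.1 (codes).
-/

noncomputable section

namespace Literature.Computability.QuantumComplexity

namespace ConeSim

open _root_.Computability Complexity Complexity.Brick Cryptography ZW ZWCode ADH

variable {N : ℕ}

/-! ### The list-level model of the table -/

/-- One gate on a table: every target gets the sum of the contributions of the whole table; the
new items are consed in turn, so the order is reversed. [folklore] -/
def tblStep (g : QGate cliffordT N) (l : List (QReg N × ZW)) : List (QReg N × ZW) :=
  (l.map fun p => (p.1, partialSum g p.1 0 l)).reverse

/-- The table through a gate list (head = first gate). [folklore] -/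
def tblRun : List (QGate cliffordT N) → List (QReg N × ZW) → List (QReg N × ZW)
  | [], l => l
  | g :: gs, l => tblRun gs (tblStep g l)

/-- A gate keeps the number of items. [folklore] -/
@[simp] theorem length_tblStep (g : QGate cliffordT N) (l : List (QReg N × ZW)) : (tblStep g l).length = l.length := by
  simp [tblStep]

/-- A run keeps the number of items. [folklore] -/
@[simp] theorem length_tblRun : ∀ (gs : List (QGate cliffordT N)) (l : List (QReg N × ZW)), (tblRun gs l).length = l.length
  | [], l => rfl
  | g :: gs, l => by rw [tblRun, length_tblRun gs, length_tblStep]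

/-- The run through `gs ++ [g]`. [folklore] -/
theorem tblRun_append_singleton : ∀ (gs : List (QGate cliffordT N)) (g : QGate cliffordT N) (l : List (QReg N × ZW)),
    tblRun (gs ++ [g]) l = tblStep g (tblRun gs l)
  | [], g, l => rfl
  | g' :: gs, g, l => by rw [List.cons_append, tblRun, tblRun, tblRun_append_singleton gs g]

/-- A gate keeps the labels, reversed. [folklore] -/
theorem map_fst_tblStep (g : QGate cliffordT N) (l : List (QReg N × ZW)) :
    (tblStep g l).map Prod.fst = (l.map Prod.fst).reverse := by
  simp [tblStep, List.map_reverse]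

/-- The rational part `U = Σ_{z₀ = 1} zwU a_z` of a table (wire `0` = first label bit).
[folklore] -/
def statU (l : List (QReg N × ZW)) : ℤ := (l.map fun p => if headBit (List.ofFn p.1) then zwU p.2 else 0).sum

/-- The `√2`-part `V = Σ_{z₀ = 1} zwV a_z` of a table. [folklore] -/
def statV (l : List (QReg N × ZW)) : ℤ := (l.map fun p => if headBit (List.ofFn p.1) then zwV p.2 else 0).sum

/-- The first bit of a label is wire `0` (and `0` on the empty register). [folklore] -/
theorem headBit_ofFn (z : QReg N) : headBit (List.ofFn z) = decide (∃ h : 0 < N, z ⟨0, h⟩ = true) := by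
  cases N with
  | zero => simp [headBit]
  | succ n => rw [List.ofFn_succ, headBit_cons]; simp

/-! ### The run of a function table is the DP -/

/-- `dpStep` does not depend on the order of the label list. [folklore] -/
theorem dpStep_perm (g : QGate cliffordT N) {l l' : List (QReg N)} (h : l.Perm l') (T : QReg N → ZW) :
    dpStep g l T = dpStep g l' T := by
  funext z
  exact (h.map _).sum_eq

/-- `dpRun` does not depend on the order of the label list. [folklore] -/
theorem dpRun_perm {l l' : List (QReg N)} (h : l.Perm l') :
    ∀ (gs : List (QGate cliffordT N)) (T : QReg N → ZW), dpRun gs l T = dpRun gs l' T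
  | [], T => rfl
  | g :: gs, T => by rw [dpRun, dpRun, dpStep_perm g h, dpRun_perm h gs]

/-- On a function table the partial sum over the whole table is `dpStep`. [folklore] -/
theorem partialSum_map (g : QGate cliffordT N) (labs : List (QReg N)) (T : QReg N → ZW) (z : QReg N) :
    partialSum g z 0 (labs.map fun w => (w, T w)) = dpStep g labs T z := by
  rw [partialSum_zero_eq_sum, dpStep, List.map_map]
  rfl

/-- One gate on a function table. [folklore] -/
theorem tblStep_map (g : QGate cliffordT N) (labs : List (QReg N)) (T : QReg N → ZW) :
    tblStep g (labs.map fun w => (w, T w)) = labs.reverse.map fun z => (z, dpStep g labs T z) := by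
  rw [tblStep, List.map_map, List.map_reverse]
  congr 1
  exact List.map_congr_left fun z _ => by simp [partialSum_map]

/-- **The run of a function table is the table of `dpRun`** over the labels reversed `|gs|`
times. [cite: NielsenChuang2010, §4.5.5] -/
theorem tblRun_map : ∀ (gs : List (QGate cliffordT N)) (labs : List (QReg N)) (T : QReg N → ZW),
    tblRun gs (labs.map fun w => (w, T w)) =
      (List.reverse^[gs.length] labs).map fun z => (z, dpRun gs labs T z)
  | [], labs, T => by simp [tblRun, dpRun]
  | g :: gs, labs, T => by
    rw [tblRun, tblStep_map, tblRun_map gs labs.reverse (dpStep g labs T), List.length_cons,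
      Function.iterate_succ_apply, dpRun, dpRun_perm (List.reverse_perm labs)]

/-- The labels of the run of a function table. [folklore] -/
theorem map_fst_tblRun_map (gs : List (QGate cliffordT N)) (labs : List (QReg N)) (T : QReg N → ZW) :
    (tblRun gs (labs.map fun w => (w, T w))).map Prod.fst = List.reverse^[gs.length] labs := by
  rw [tblRun_map, List.map_map]
  exact List.map_id'' (fun _ => rfl) _

/-- Iterated reversal is a permutation. [folklore] -/
theorem iterate_reverse_perm (k : ℕ) (labs : List (QReg N)) : (List.reverse^[k] labs).Perm labs := by
  induction k with
  | zero => exact List.Perm.refl _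
  | succ k ih => rw [Function.iterate_succ_apply']; exact (List.reverse_perm _).trans ih

/-- `statU` of a function table is `accU`. [folklore] -/
theorem statU_map (labs : List (QReg N)) (T : QReg N → ZW) :
    statU (labs.map fun w => (w, T w)) = accU labs T := by
  rw [statU, accU, List.map_map]
  congr 1
  refine List.map_congr_left fun z _ => ?_
  simp only [Function.comp_apply, headBit_ofFn]
  by_cases h : ∃ h : 0 < N, z ⟨0, h⟩ = true
  · rw [decide_eq_true h, if_pos rfl, if_pos h]
  · rw [decide_eq_false h, if_neg Bool.false_ne_true, if_neg h]

/-- `statV` of a function table is `accV`. [folklore] -/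
theorem statV_map (labs : List (QReg N)) (T : QReg N → ZW) :
    statV (labs.map fun w => (w, T w)) = accV labs T := by
  rw [statV, accV, List.map_map]
  congr 1
  refine List.map_congr_left fun z _ => ?_
  simp only [Function.comp_apply, headBit_ofFn]
  by_cases h : ∃ h : 0 < N, z ⟨0, h⟩ = true
  · rw [decide_eq_true h, if_pos rfl, if_pos h]
  · rw [decide_eq_false h, if_neg Bool.false_ne_true, if_neg h]

/-- `accU` does not depend on the order of the labels. [folklore] -/
theorem accU_perm {l l' : List (QReg N)} (h : l.Perm l') (T : QReg N → ZW) : accU l T = accU l' T :=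
  (h.map _).sum_eq

/-- `accV` does not depend on the order of the labels. [folklore] -/
theorem accV_perm {l l' : List (QReg N)} (h : l.Perm l') (T : QReg N → ZW) : accV l T = accV l' T :=
  (h.map _).sum_eq

/-! ### Coefficient growth -/

/-- All coordinates have modulus `≤ M`. [folklore] -/
def Bdd (M : ℕ) (a : ZW) : Prop := ∀ i, (a i).natAbs ≤ M

/-- `0` is bounded by anything. [folklore] -/
theorem bdd_zero (M : ℕ) : Bdd M (0 : ZW) := fun i => by simp

/-- Bounds are monotone. [folklore] -/
theorem Bdd.mono {M M' : ℕ} {a : ZW} (h : Bdd M a) (hM : M ≤ M') : Bdd M' a := fun i => (h i).trans hM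

/-- Sums add bounds. [folklore] -/
theorem Bdd.add {M M' : ℕ} {a b : ZW} (ha : Bdd M a) (hb : Bdd M' b) : Bdd (M + M') (a + b) := fun i => by
  have := Int.natAbs_add_le (a i) (b i)
  have h1 := ha i; have h2 := hb i
  simp only [Pi.add_apply]
  omega

/-- A rotation keeps the bound. [folklore] -/
theorem bdd_mulOmega {M : ℕ} {a : ZW} (h : Bdd M a) : Bdd M (mulOmega a) := fun i => by
  fin_cases i <;> simp [ZW.mulOmega, h 0, h 1, h 2, h 3]

/-- Iterated rotations keep the bound. [folklore] -/
theorem bdd_mulOmegaPow {M : ℕ} {a : ZW} (h : Bdd M a) (k : ℕ) : Bdd M (mulOmegaPow k a) := by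
  induction k with
  | zero => simpa [ZW.mulOmegaPow] using h
  | succ k ih => rw [ZW.mulOmegaPow, Function.iterate_succ_apply', ← ZW.mulOmegaPow]; exact bdd_mulOmega ih

/-- A contribution keeps the bound. [folklore] -/
theorem bdd_contribBit {M : ℕ} {a : ZW} (h : Bdd M a) (g : QGate cliffordT N) (c : Bool) (w z : QReg N) :
    Bdd M (contribBit g c w z a) := by
  unfold QuantumComplexity.contribBit
  rcases pathStep g c w with _ | ⟨w', ψ⟩
  · exact bdd_zero M
  · simp only
    split_ifs
    · exact bdd_mulOmegaPow h _
    · exact bdd_zero M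

/-- Both contributions of an item are bounded by twice the bound. [folklore] -/
theorem bdd_contrib {M : ℕ} {a : ZW} (h : Bdd M a) (g : QGate cliffordT N) (w z : QReg N) :
    Bdd (2 * M) (contrib g w z a) := by
  rw [two_mul]; exact (bdd_contribBit h g false w z).add (bdd_contribBit h g true w z)

/-- A sum of `n` terms bounded by `M` is bounded by `n M`. [folklore] -/
theorem bdd_list_sum {α : Type*} {M : ℕ} (l : List α) (f : α → ZW) (h : ∀ x ∈ l, Bdd M (f x)) :
    Bdd (l.length * M) (l.map f).sum := by
  induction l with
  | nil => simpa using bdd_zero 0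
  | cons x l ih =>
    rw [List.map_cons, List.sum_cons, List.length_cons, Nat.succ_mul, add_comm (l.length * M)]
    exact (h x (by simp)).add (ih fun y hy => h y (by simp [hy]))

/-- **A partial sum over a prefix of a bounded table is bounded by `2 |prefix| M`.** [folklore] -/
theorem bdd_partialSum {M : ℕ} (g : QGate cliffordT N) (z : QReg N) (l : List (QReg N × ZW))
    (h : ∀ p ∈ l, Bdd M p.2) : Bdd (l.length * (2 * M)) (partialSum g z 0 l) := by
  rw [partialSum_zero_eq_sum]
  exact bdd_list_sum l _ fun p hp => bdd_contrib (h p hp) g p.1 z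

/-- **One gate multiplies the bound by `2L`.** [folklore] -/
theorem bdd_tblStep {M : ℕ} (g : QGate cliffordT N) (l : List (QReg N × ZW)) (h : ∀ p ∈ l, Bdd M p.2) :
    ∀ p ∈ tblStep g l, Bdd (2 * l.length * M) p.2 := by
  intro p hp
  simp only [tblStep, List.mem_reverse, List.mem_map] at hp
  obtain ⟨q, -, rfl⟩ := hp
  have e : 2 * l.length * M = l.length * (2 * M) := by ring
  rw [e]
  exact bdd_partialSum g q.1 l h

/-- **A run of `t` gates multiplies the bound by `(2L)^t`.** [folklore] -/
theorem bdd_tblRun {M : ℕ} : ∀ (gs : List (QGate cliffordT N)) (l : List (QReg N × ZW)),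
    (∀ p ∈ l, Bdd M p.2) → ∀ p ∈ tblRun gs l, Bdd ((2 * l.length) ^ gs.length * M) p.2
  | [], l, h => by simpa [tblRun] using h
  | g :: gs, l, h => by
    intro p hp
    rw [tblRun] at hp
    have h1 := bdd_tblRun gs (tblStep g l) (bdd_tblStep g l h) p hp
    rw [length_tblStep] at h1
    have e : (2 * l.length) ^ (gs.length + 1) * M = (2 * l.length) ^ gs.length * (2 * l.length * M) := by ring
    rw [List.length_cons, e]
    exact h1

/-- The initial table of `|w₀⟩` is bounded by `1`. [folklore] -/
theorem bdd_dpInit (w₀ z : QReg N) : Bdd 1 (dpInit w₀ z) := fun i => by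
  unfold dpInit
  split_ifs
  · fin_cases i <;> simp [ZW.one]
  · simp

/-! ### Length bounds along a run -/

/-- The code of a bounded amplitude: `≤ 14B + 20` symbols if `M < 2^B`. [folklore] -/
theorem length_enc_le_of_bdd {M B : ℕ} {a : ZW} (h : Bdd M a) (hM : M < 2 ^ B) : (enc a).length ≤ 14 * B + 20 :=
  length_enc_le fun i => lt_of_le_of_lt (h i) hM

/-- The code of an item. [folklore] -/
theorem length_itemEnc (p : QReg N × ZW) : (itemEnc p).length = 2 * N + 2 + (enc p.2).length := by
  rw [itemEnc, length_boolPair, List.length_ofFn]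

/-- **The code of a bounded table**: `≤ L (4N + 28B + 46)` symbols. [folklore] -/
theorem length_tableEnc_le {M B : ℕ} (l : List (QReg N × ZW)) (h : ∀ p ∈ l, Bdd M p.2) (hM : M < 2 ^ B) :
    (tableEnc l).length ≤ l.length * (4 * N + 28 * B + 46) := by
  rw [tableEnc, length_encList, List.map_map]
  induction l with
  | nil => simp
  | cons p l ih =>
    rw [List.map_cons, List.sum_cons, List.length_cons, Nat.succ_mul]
    have h1 : 2 * (itemEnc p).length + 2 ≤ 4 * N + 28 * B + 46 := by
      rw [length_itemEnc]
      have := length_enc_le_of_bdd (h p (by simp)) hM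
      omega
    have h2 := ih fun q hq => h q (by simp [hq])
    simp only [Function.comp_apply] at h2 ⊢
    omega

/-- `(2L)^t ≤ 2^{t (k+1)}` for `L ≤ 2^k`. [folklore] -/
theorem two_mul_pow_le {L k : ℕ} (hL : L ≤ 2 ^ k) (t : ℕ) : (2 * L) ^ t ≤ 2 ^ (t * (k + 1)) := by
  calc (2 * L) ^ t ≤ (2 * 2 ^ k) ^ t := Nat.pow_le_pow_left (Nat.mul_le_mul_left 2 hL) t
    _ = 2 ^ (t * (k + 1)) := by rw [← pow_succ', ← pow_mul, mul_comm]

/-- The rational norm part of a bounded amplitude. [folklore] -/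
theorem natAbs_zwU_le {M : ℕ} {a : ZW} (h : Bdd M a) : (zwU a).natAbs ≤ 4 * (M * M) := by
  unfold zwU
  have h0 := h 0; have h1 := h 1; have h2 := h 2; have h3 := h 3
  have e : ∀ x : ℤ, (x * x).natAbs = x.natAbs * x.natAbs := fun x => Int.natAbs_mul x x
  calc (a 0 * a 0 + a 1 * a 1 + a 2 * a 2 + a 3 * a 3).natAbs
      ≤ (a 0 * a 0).natAbs + (a 1 * a 1).natAbs + (a 2 * a 2).natAbs + (a 3 * a 3).natAbs := by
        refine le_trans (Int.natAbs_add_le _ _) (Nat.add_le_add_right ?_ _)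
        refine le_trans (Int.natAbs_add_le _ _) (Nat.add_le_add_right ?_ _)
        exact Int.natAbs_add_le _ _
    _ ≤ 4 * (M * M) := by
        rw [e, e, e, e]
        nlinarith [Nat.mul_le_mul h0 h0, Nat.mul_le_mul h1 h1, Nat.mul_le_mul h2 h2, Nat.mul_le_mul h3 h3]

/-- The `√2` norm part of a bounded amplitude. [folklore] -/
theorem natAbs_zwV_le {M : ℕ} {a : ZW} (h : Bdd M a) : (zwV a).natAbs ≤ 4 * (M * M) := by
  unfold zwV
  have h0 := h 0; have h1 := h 1; have h2 := h 2; have h3 := h 3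
  have e : ∀ x y : ℤ, (x * y).natAbs = x.natAbs * y.natAbs := fun x y => Int.natAbs_mul x y
  calc (a 0 * a 1 + a 1 * a 2 + a 2 * a 3 - a 3 * a 0).natAbs
      ≤ (a 0 * a 1).natAbs + (a 1 * a 2).natAbs + (a 2 * a 3).natAbs + (a 3 * a 0).natAbs := by
        refine le_trans (Int.natAbs_sub_le _ _) (Nat.add_le_add_right ?_ _)
        refine le_trans (Int.natAbs_add_le _ _) (Nat.add_le_add_right ?_ _)
        exact Int.natAbs_add_le _ _
    _ ≤ 4 * (M * M) := by
        rw [e, e, e, e]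
        nlinarith [Nat.mul_le_mul h0 h1, Nat.mul_le_mul h1 h2, Nat.mul_le_mul h2 h3, Nat.mul_le_mul h3 h0]

/-- `statU` of a bounded table. [folklore] -/
theorem natAbs_statU_le {M : ℕ} (l : List (QReg N × ZW)) (h : ∀ p ∈ l, Bdd M p.2) :
    (statU l).natAbs ≤ l.length * (4 * (M * M)) := by
  unfold statU
  induction l with
  | nil => simp
  | cons p l ih =>
    rw [List.map_cons, List.sum_cons, List.length_cons, Nat.succ_mul, add_comm (l.length * _)]
    refine le_trans (Int.natAbs_add_le _ _) (Nat.add_le_add ?_ (ih fun q hq => h q (by simp [hq])))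
    split_ifs
    · exact natAbs_zwU_le (h p (by simp))
    · simp

/-- `statV` of a bounded table. [folklore] -/
theorem natAbs_statV_le {M : ℕ} (l : List (QReg N × ZW)) (h : ∀ p ∈ l, Bdd M p.2) :
    (statV l).natAbs ≤ l.length * (4 * (M * M)) := by
  unfold statV
  induction l with
  | nil => simp
  | cons p l ih =>
    rw [List.map_cons, List.sum_cons, List.length_cons, Nat.succ_mul, add_comm (l.length * _)]
    refine le_trans (Int.natAbs_add_le _ _) (Nat.add_le_add ?_ (ih fun q hq => h q (by simp [hq])))
    split_ifs
    · exact natAbs_zwV_le (h p (by simp))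
    · simp

/-! ### Window labels -/

/-- **The machine's numeral is the tree's `natBits`**: for `j < 2^k`, the `k`-bit little-endian
numeral `Complexity.natBits k j` (`StackUnaryBits.lean`) is `(bin j ++ 0^k) ↾ k`, which is what the
front end of the simulator computes. [folklore] -/
theorem natBits_eq_take {k j : ℕ} (hj : j < 2 ^ k) :
    Complexity.natBits k j = (encodeNat j ++ List.replicate k false).take k := by
  have hl : (encodeNat j).length ≤ k := (length_encodeNat_le_iff j k).2 hj
  refine Kannan.eq_of_bitsToNat_eq (by simp) ?_
  rw [bitsToNat_natBits hj, List.take_append, List.take_of_length_le hl, List.take_replicate,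
    bitsToNat_append, bitsToNat_replicate_false]
  simp

/-- `natBits k` is injective below `2^k`. [folklore] -/
theorem natBits_injOn {k j j' : ℕ} (hj : j < 2 ^ k) (hj' : j' < 2 ^ k)
    (h : Complexity.natBits k j = Complexity.natBits k j') : j = j' := by
  rw [← bitsToNat_natBits hj, ← bitsToNat_natBits hj', h]

/-- The bit list of the window label `j`: `natBits k j` followed by the suffix of the base label
from position `k` on. [folklore] -/
def winBits (k : ℕ) (w₀ : QReg N) (j : ℕ) : List Bool := Complexity.natBits k j ++ (List.ofFn w₀).drop k

/-- Window label bit lists have length `N` (`k ≤ N`). [folklore] -/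
theorem length_winBits {k : ℕ} (hk : k ≤ N) (w₀ : QReg N) (j : ℕ) : (winBits k w₀ j).length = N := by
  simp [winBits]; omega

/-- **The window label `j`** as a register label (`k ≤ N`). [folklore] -/
def winLab (k : ℕ) (hk : k ≤ N) (w₀ : QReg N) (j : ℕ) : QReg N :=
  fun i => (winBits k w₀ j).get ⟨i, by rw [length_winBits hk]; exact i.2⟩

/-- The bit list of a window label. [folklore] -/
@[simp] theorem ofFn_winLab {k : ℕ} (hk : k ≤ N) (w₀ : QReg N) (j : ℕ) : List.ofFn (winLab k hk w₀ j) = winBits k w₀ j := by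
  apply List.ext_get
  · rw [List.length_ofFn, length_winBits hk]
  · intro i h1 h2
    simp [winLab]

/-- **The set of window labels**: the labels agreeing with `w₀` from position `k` on. [folklore] -/
def winSet (k : ℕ) (w₀ : QReg N) : Set (QReg N) := {y | ∀ i : Fin N, k ≤ (i : ℕ) → y i = w₀ i}

/-- The base label is a window label. [folklore] -/
theorem base_mem_winSet (k : ℕ) (w₀ : QReg N) : w₀ ∈ winSet k w₀ := fun _ _ => rfl

/-- A window label agrees with the base off the window. [folklore] -/
theorem winLab_mem_winSet {k : ℕ} (hk : k ≤ N) (w₀ : QReg N) (j : ℕ) : winLab k hk w₀ j ∈ winSet k w₀ := by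
  intro i hi
  simp only [winLab, winBits, List.get_eq_getElem]
  rw [List.getElem_append_right (by simp; omega)]
  simp only [length_natBits, List.getElem_drop, List.getElem_ofFn]
  congr 1
  ext; simp; omega

/-- The first `k` bits of a window label. [folklore] -/
theorem take_ofFn_winLab {k : ℕ} (hk : k ≤ N) (w₀ : QReg N) (j : ℕ) :
    (List.ofFn (winLab k hk w₀ j)).take k = Complexity.natBits k j := by
  rw [ofFn_winLab, winBits, List.take_append_of_le_length (by simp)]
  simp

/-- **Every label of the window set is a window label**: `y = winLab (value of its first k bits)`.
[folklore] -/
theorem eq_winLab_of_mem_winSet {k : ℕ} (hk : k ≤ N) {w₀ y : QReg N} (hy : y ∈ winSet k w₀) :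
    y = winLab k hk w₀ (bitsToNat ((List.ofFn y).take k)) := by
  set u := (List.ofFn y).take k with hu_def
  have hu : u.length = k := by simp [hu_def]; omega
  have hp : Complexity.natBits k (bitsToNat u) = u := by rw [← hu]; exact CoinEnum.natBits_bitsToNat u
  have hdrop : (List.ofFn y).drop k = (List.ofFn w₀).drop k := by
    apply List.ext_getElem
    · simp
    · intro i h1 h2
      simp only [List.getElem_drop, List.getElem_ofFn]
      exact hy _ (by simp)
  have hbits : List.ofFn y = winBits k w₀ (bitsToNat u) := by
    rw [winBits, hp, ← hdrop, hu_def, List.take_append_drop]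
  apply List.ofFn_injective
  rw [ofFn_winLab]
  exact hbits

/-- The value of the first `k` bits of a label is below `2^k`. [folklore] -/
theorem bitsToNat_take_lt (y : QReg N) (k : ℕ) (hk : k ≤ N) : bitsToNat ((List.ofFn y).take k) < 2 ^ k := by
  have := bitsToNat_lt ((List.ofFn y).take k)
  rwa [List.length_take, List.length_ofFn, Nat.min_eq_left hk] at this

/-- **The enumeration of the window labels**: `winLab j` for `j < 2^k`. [folklore] -/
def winLabs (k : ℕ) (hk : k ≤ N) (w₀ : QReg N) : List (QReg N) := (List.range (2 ^ k)).map (winLab k hk w₀)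

/-- There are `2^k` window labels. [folklore] -/
@[simp] theorem length_winLabs (k : ℕ) (hk : k ≤ N) (w₀ : QReg N) : (winLabs k hk w₀).length = 2 ^ k := by
  simp [winLabs]

/-- **The enumeration has no duplicates.** [folklore] -/
theorem nodup_winLabs (k : ℕ) (hk : k ≤ N) (w₀ : QReg N) : (winLabs k hk w₀).Nodup := by
  refine List.Nodup.map_on (fun j hj j' hj' h => ?_) (List.nodup_range)
  rw [List.mem_range] at hj hj'
  have := congrArg (fun y => (List.ofFn y).take k) h
  simp only [take_ofFn_winLab] at this
  exact natBits_injOn hj hj' this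

/-- **The enumeration lists exactly the window set.** [folklore] -/
theorem mem_winLabs_iff (k : ℕ) (hk : k ≤ N) (w₀ y : QReg N) : y ∈ winLabs k hk w₀ ↔ y ∈ winSet k w₀ := by
  constructor
  · intro h
    obtain ⟨j, -, rfl⟩ := List.mem_map.1 h
    exact winLab_mem_winSet hk w₀ j
  · intro hy
    exact List.mem_map.2 ⟨_, List.mem_range.2 (bitsToNat_take_lt y k hk), (eq_winLab_of_mem_winSet hk hy).symm⟩

/-- **The window set is closed under the path steps of gates acting below `k`.** [folklore] -/
theorem winSet_closed (k : ℕ) (w₀ : QReg N) (g : QGate cliffordT N) (hg : ∀ i ∈ g.wires, (i : ℕ) < k)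
    (c : Bool) (w : QReg N) (hw : w ∈ winSet k w₀) (w' : QReg N) (ψ : ℕ) (h : pathStep g c w = some (w', ψ)) :
    w' ∈ winSet k w₀ := by
  intro i hi
  have hne : ∀ j ∈ g.wires, j ≠ i := fun j hj hji => by have := hg j hj; subst hji; omega
  cases g with
  | oracle k' e => simp [pathStep] at h
  | gate op e =>
    have hmem : ∀ t, e t ∈ (QGate.gate op e : QGate cliffordT N).wires := fun t => by simp [QGate.wires]
    have hupd : ∀ (j : Fin N) (v : Bool), j ∈ (QGate.gate op e : QGate cliffordT N).wires →
        Function.update w j v i = w i := fun j v hj => Function.update_of_ne (Ne.symm (hne j hj)) _ _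
    cases op <;> simp only [pathStep] at h
    · simp only [Option.some.injEq, Prod.mk.injEq] at h
      obtain ⟨rfl, -⟩ := h
      rw [hupd ((embH e) 0) c (hmem (0 : Fin 1)), hw i hi]
    · cases c <;> simp at h
      obtain ⟨rfl, -⟩ := h
      exact hw i hi
    · cases c <;> simp at h
      obtain ⟨rfl, -⟩ := h
      exact hw i hi
    · cases c <;> simp at h
      obtain ⟨rfl, -⟩ := h
      rw [hupd ((embC e) 1) _ (hmem (1 : Fin 2)), hw i hi]

end ConeSim

end Literature.Computability.QuantumComplexity

end
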